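import Summits.Schanuel.Schanuel.Theorems.ZilberEacCurveGraphFibreCase
import HarnessLib

/-!
# The exponential-polynomial regime, CXII: the certificate for GRAPH FIBRES INVOLVING `y₁` —
# `{A(x₀, x₁) = 0, y₀ = R(x₀, x₁, y₁)}` is an irreducible surface of Mantova–Masser's case

HONEST FRAMING.  Cell `pub-schanuel` (Zilber's Exponential-Algebraic Closedness, case ladder;
host summit Schanuel), seat 2, gen 34.  File VI of gen 28 (`ZilberEacCurveGraphFibreSurface`,
`…Case`) certifies the surfaces `{A = 0, y₀ = R(x₀, x₁)}`.  Mantova–Masser's flagged example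
(fermat) `X₁⁹ + X₂⁹ = 1`, `X̂₁ + X̂₂ = 1` has the fibre `y₀ = 1 − y₁`, a graph over `(x, y₁)` whose
right-hand side involves `y₁`.  This file is the same certificate for
`S(A; R) = {(x₀, x₁, y₀, y₁) : A(x₀, x₁) = 0, y₀ = R(x₀, x₁, y₁)}`, `R ∈ ℂ[X₀, X₁, X₂]`:
**`relGraphFibre_eq_zeroLocus`** (`S = Z(θ⁻¹((Ã)))` for the surjective substitution
`θ : x₀ ↦ X₀, x₁ ↦ X₁, y₀ ↦ R, y₁ ↦ X₂`), **`isIrreducibleClosed_relGraphFibre`**,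
**`zariskiDim_relGraphFibre`** (`= 2`), **`vanishingIdeal_projAdd_relGraphFibre`** (`= (A)`, given
a point of the curve and `t ≠ 0` with `R(x, t) ≠ 0`), and the case certificate
**`mmCase_relGraphFibre`**.  [folklore algebraic geometry]; nothing here is specific to Schanuel's
conjecture (neither used nor implied); Mantova–Masser's question (PLMS 2024 §1 p. 5) and EC(3,2)
stay OPEN.
-/

noncomputable section

open Set Complex MvPolynomial
open Literature.NumberTheory.Transcendental Literature.ModelTheory.Zilber
open Literature.ModelTheory.ExponentialFields

set_option linter.dupNamespace false

namespace Summit.Schanuel.Schanuel.Theorems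

section RelGraphFibre

variable (A : MvPolynomial (Fin 2) ℂ) (R : MvPolynomial (Fin 3) ℂ)

/-- The substitution `θ` evaluated at `(w(x₀), w(x₁), w(y₁))` is evaluation at `w`, on variables,
for `w` with `w(y₀) = R(w(x₀), w(x₁), w(y₁))`. -/
theorem eval_relGraphSubst {w : Fin 2 ⊕ Fin 2 → ℂ}
    (hw : w (Sum.inr 0) = MvPolynomial.eval ![w (Sum.inl 0), w (Sum.inl 1), w (Sum.inr 1)] R)
    (v : Fin 2 ⊕ Fin 2) :
    eval ![w (Sum.inl 0), w (Sum.inl 1), w (Sum.inr 1)]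
      ((Sum.elim ![MvPolynomial.X 0, MvPolynomial.X 1] ![R, MvPolynomial.X 2] :
          Fin 2 ⊕ Fin 2 → MvPolynomial (Fin 3) ℂ) v) = w v := by
  rcases v with i | i
  · fin_cases i
    · simp
    · simp
  · fin_cases i
    · show eval ![w (Sum.inl 0), w (Sum.inl 1), w (Sum.inr 1)] R = w (Sum.inr 0)
      rw [hw]
    · simp

/-- `θ` followed by evaluation at `(w(x₀), w(x₁), w(y₁))` is evaluation at `w`. -/
theorem eval_aeval_relGraphSubst {w : Fin 2 ⊕ Fin 2 → ℂ}
    (hw : w (Sum.inr 0) = MvPolynomial.eval ![w (Sum.inl 0), w (Sum.inl 1), w (Sum.inr 1)] R)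
    (f : MvPolynomial (Fin 2 ⊕ Fin 2) ℂ) :
    eval ![w (Sum.inl 0), w (Sum.inl 1), w (Sum.inr 1)]
      (aeval (Sum.elim ![MvPolynomial.X 0, MvPolynomial.X 1] ![R, MvPolynomial.X 2] :
          Fin 2 ⊕ Fin 2 → MvPolynomial (Fin 3) ℂ) f) = aeval w f := by
  have h : (fun v => eval ![w (Sum.inl 0), w (Sum.inl 1), w (Sum.inr 1)]
      ((Sum.elim ![MvPolynomial.X 0, MvPolynomial.X 1] ![R, MvPolynomial.X 2] :
          Fin 2 ⊕ Fin 2 → MvPolynomial (Fin 3) ℂ) v)) = w :=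
    funext (eval_relGraphSubst R hw)
  rw [eval_aeval_eq_aeval, h]

/-- `θ` is onto (`X₀ ↦ x₀`, `X₁ ↦ x₁`, `X₂ ↦ y₁` is a section). -/
theorem relGraphSubst_surjective : Function.Surjective
    (aeval (Sum.elim ![MvPolynomial.X 0, MvPolynomial.X 1] ![R, MvPolynomial.X 2] :
          Fin 2 ⊕ Fin 2 → MvPolynomial (Fin 3) ℂ) :
      MvPolynomial (Fin 2 ⊕ Fin 2) ℂ →ₐ[ℂ] MvPolynomial (Fin 3) ℂ) := by
  intro r
  let back : Fin 3 → Fin 2 ⊕ Fin 2 := ![Sum.inl 0, Sum.inl 1, Sum.inr 1]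
  refine ⟨rename back r, ?_⟩
  rw [aeval_rename]
  have hX : ((Sum.elim ![MvPolynomial.X 0, MvPolynomial.X 1] ![R, MvPolynomial.X 2] :
          Fin 2 ⊕ Fin 2 → MvPolynomial (Fin 3) ℂ) ∘ back) = MvPolynomial.X := by
    funext j
    fin_cases j <;> simp [back]
  rw [hX, MvPolynomial.aeval_X_left_apply]

/-- **`S(A; R) = Z(θ⁻¹((Ã)))`**, `Ã = A(X₀, X₁) ∈ ℂ[X₀, X₁, X₂]`. (new) -/
theorem relGraphFibre_eq_zeroLocus :
    {w : Fin 2 ⊕ Fin 2 → ℂ | MvPolynomial.eval ![w (Sum.inl 0), w (Sum.inl 1)] A = 0 ∧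
      w (Sum.inr 0) = MvPolynomial.eval ![w (Sum.inl 0), w (Sum.inl 1), w (Sum.inr 1)] R} =
    zeroLocus ℂ (Ideal.comap (aeval (Sum.elim ![MvPolynomial.X 0, MvPolynomial.X 1]
        ![R, MvPolynomial.X 2] : Fin 2 ⊕ Fin 2 → MvPolynomial (Fin 3) ℂ) :
        MvPolynomial (Fin 2 ⊕ Fin 2) ℂ →ₐ[ℂ] MvPolynomial (Fin 3) ℂ)
      (Ideal.span {rename (Fin.castSucc : Fin 2 → Fin 3) A})) := by
  ext w
  rw [mem_zeroLocus_iff]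
  constructor
  · rintro ⟨hwA, hwR⟩ f hf
    rw [Ideal.mem_comap, Ideal.mem_span_singleton] at hf
    obtain ⟨r, hr⟩ := hf
    rw [← eval_aeval_relGraphSubst R hwR, hr, map_mul, eval_rename]
    have e : ((![w (Sum.inl 0), w (Sum.inl 1), w (Sum.inr 1)] : Fin 3 → ℂ) ∘
        (Fin.castSucc : Fin 2 → Fin 3)) = ![w (Sum.inl 0), w (Sum.inl 1)] := by
      funext j; fin_cases j <;> rfl
    rw [e, hwA, zero_mul]
  · intro h
    have hwR : w (Sum.inr 0) =
        MvPolynomial.eval ![w (Sum.inl 0), w (Sum.inl 1), w (Sum.inr 1)] R := by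
      have hmem : (MvPolynomial.X (Sum.inr 0) -
          rename (![Sum.inl 0, Sum.inl 1, Sum.inr 1] : Fin 3 → Fin 2 ⊕ Fin 2) R :
          MvPolynomial (Fin 2 ⊕ Fin 2) ℂ) ∈
          Ideal.comap (aeval (Sum.elim ![MvPolynomial.X 0, MvPolynomial.X 1]
              ![R, MvPolynomial.X 2] : Fin 2 ⊕ Fin 2 → MvPolynomial (Fin 3) ℂ) :
              MvPolynomial (Fin 2 ⊕ Fin 2) ℂ →ₐ[ℂ] MvPolynomial (Fin 3) ℂ)
            (Ideal.span {rename (Fin.castSucc : Fin 2 → Fin 3) A}) := by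
        rw [Ideal.mem_comap]
        have hfg : ((Sum.elim ![MvPolynomial.X 0, MvPolynomial.X 1] ![R, MvPolynomial.X 2] :
              Fin 2 ⊕ Fin 2 → MvPolynomial (Fin 3) ℂ) ∘
              (![Sum.inl 0, Sum.inl 1, Sum.inr 1] : Fin 3 → Fin 2 ⊕ Fin 2)) = MvPolynomial.X := by
          funext j; fin_cases j <;> rfl
        have e : aeval (Sum.elim ![MvPolynomial.X 0, MvPolynomial.X 1] ![R, MvPolynomial.X 2] :
              Fin 2 ⊕ Fin 2 → MvPolynomial (Fin 3) ℂ)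
            (MvPolynomial.X (Sum.inr 0) -
              rename (![Sum.inl 0, Sum.inl 1, Sum.inr 1] : Fin 3 → Fin 2 ⊕ Fin 2) R :
              MvPolynomial (Fin 2 ⊕ Fin 2) ℂ) = 0 := by
          rw [map_sub, MvPolynomial.aeval_X, aeval_rename, hfg, MvPolynomial.aeval_X_left_apply]
          simp
        rw [e]; exact Ideal.zero_mem _
      have h1 := h _ hmem
      rw [map_sub, MvPolynomial.aeval_X, sub_eq_zero, aeval_rename] at h1
      have e : (w ∘ (![Sum.inl 0, Sum.inl 1, Sum.inr 1] : Fin 3 → Fin 2 ⊕ Fin 2)) =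
          ![w (Sum.inl 0), w (Sum.inl 1), w (Sum.inr 1)] := by
        funext j; fin_cases j <;> rfl
      rw [h1, e]
      rfl
    refine ⟨?_, hwR⟩
    have hmem : (rename (Sum.inl : Fin 2 → Fin 2 ⊕ Fin 2) A : MvPolynomial (Fin 2 ⊕ Fin 2) ℂ) ∈
        Ideal.comap (aeval (Sum.elim ![MvPolynomial.X 0, MvPolynomial.X 1]
            ![R, MvPolynomial.X 2] : Fin 2 ⊕ Fin 2 → MvPolynomial (Fin 3) ℂ) :
            MvPolynomial (Fin 2 ⊕ Fin 2) ℂ →ₐ[ℂ] MvPolynomial (Fin 3) ℂ)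
          (Ideal.span {rename (Fin.castSucc : Fin 2 → Fin 3) A}) := by
      have hfg : ((Sum.elim ![MvPolynomial.X 0, MvPolynomial.X 1] ![R, MvPolynomial.X 2] :
            Fin 2 ⊕ Fin 2 → MvPolynomial (Fin 3) ℂ) ∘ (Sum.inl : Fin 2 → Fin 2 ⊕ Fin 2)) =
          MvPolynomial.X ∘ (Fin.castSucc : Fin 2 → Fin 3) := by
        funext j; fin_cases j <;> rfl
      rw [Ideal.mem_comap, aeval_rename, hfg, ← rename_eq_aeval (R := ℂ)]
      exact Ideal.mem_span_singleton_self _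
    have h1 := h _ hmem
    rw [aeval_rename] at h1
    have e : (w ∘ (Sum.inl : Fin 2 → Fin 2 ⊕ Fin 2)) = ![w (Sum.inl 0), w (Sum.inl 1)] := by
      funext j; fin_cases j <;> rfl
    rw [e] at h1
    rw [← MvPolynomial.coe_aeval_eq_eval]
    exact h1

variable {A}

/-- **`S(A; R)` is an irreducible closed set** for irreducible `A ∈ ℂ[x₀, x₁]`. (new) -/
theorem isIrreducibleClosed_relGraphFibre (hirr : Irreducible A) :
    IsIrreducibleClosed ℂ {w : Fin 2 ⊕ Fin 2 → ℂ |
      MvPolynomial.eval ![w (Sum.inl 0), w (Sum.inl 1)] A = 0 ∧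
      w (Sum.inr 0) = MvPolynomial.eval ![w (Sum.inl 0), w (Sum.inl 1), w (Sum.inr 1)] R} := by
  have hprime : Prime (rename (Fin.castSucc : Fin 2 → Fin 3) A) :=
    UniqueFactorizationMonoid.irreducible_iff_prime.1 (irreducible_rename_castSucc₂ hirr)
  haveI : (Ideal.span {rename (Fin.castSucc : Fin 2 → Fin 3) A} :
      Ideal (MvPolynomial (Fin 3) ℂ)).IsPrime :=
    (Ideal.span_singleton_prime hprime.ne_zero).2 hprime
  haveI : (Ideal.comap (aeval (Sum.elim ![MvPolynomial.X 0, MvPolynomial.X 1]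
        ![R, MvPolynomial.X 2] : Fin 2 ⊕ Fin 2 → MvPolynomial (Fin 3) ℂ) :
        MvPolynomial (Fin 2 ⊕ Fin 2) ℂ →ₐ[ℂ] MvPolynomial (Fin 3) ℂ)
      (Ideal.span {rename (Fin.castSucc : Fin 2 → Fin 3) A})).IsPrime := Ideal.IsPrime.comap _
  rw [relGraphFibre_eq_zeroLocus]
  exact isIrreducibleClosed_zeroLocus _

/-- **`dim S(A; R) = 2`**: `ℂ[S] ≅ ℂ[X₀, X₁, X₂]/(Ã)`. (new) -/
theorem zariskiDim_relGraphFibre (hirr : Irreducible A) :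
    zariskiDim ℂ {w : Fin 2 ⊕ Fin 2 → ℂ |
      MvPolynomial.eval ![w (Sum.inl 0), w (Sum.inl 1)] A = 0 ∧
      w (Sum.inr 0) = MvPolynomial.eval ![w (Sum.inl 0), w (Sum.inl 1), w (Sum.inr 1)] R} =
      (2 : ℕ) := by
  have hprime : Prime (rename (Fin.castSucc : Fin 2 → Fin 3) A) :=
    UniqueFactorizationMonoid.irreducible_iff_prime.1 (irreducible_rename_castSucc₂ hirr)
  haveI : (Ideal.span {rename (Fin.castSucc : Fin 2 → Fin 3) A} :
      Ideal (MvPolynomial (Fin 3) ℂ)).IsPrime :=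
    (Ideal.span_singleton_prime hprime.ne_zero).2 hprime
  haveI : (Ideal.comap (aeval (Sum.elim ![MvPolynomial.X 0, MvPolynomial.X 1]
        ![R, MvPolynomial.X 2] : Fin 2 ⊕ Fin 2 → MvPolynomial (Fin 3) ℂ) :
        MvPolynomial (Fin 2 ⊕ Fin 2) ℂ →ₐ[ℂ] MvPolynomial (Fin 3) ℂ)
      (Ideal.span {rename (Fin.castSucc : Fin 2 → Fin 3) A})).IsPrime := Ideal.IsPrime.comap _
  rw [relGraphFibre_eq_zeroLocus, zariskiDim_zeroLocus_eq]
  set J : Ideal (MvPolynomial (Fin 3) ℂ) := Ideal.span {rename (Fin.castSucc : Fin 2 → Fin 3) A}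
    with hJ
  let f : MvPolynomial (Fin 2 ⊕ Fin 2) ℂ →ₐ[ℂ] (MvPolynomial (Fin 3) ℂ ⧸ J) :=
    (Ideal.Quotient.mkₐ ℂ J).comp (aeval (Sum.elim ![MvPolynomial.X 0, MvPolynomial.X 1]
        ![R, MvPolynomial.X 2] : Fin 2 ⊕ Fin 2 → MvPolynomial (Fin 3) ℂ))
  have hf : Function.Surjective f :=
    (Ideal.Quotient.mkₐ_surjective ℂ J).comp (relGraphSubst_surjective R)
  have hker : RingHom.ker f = Ideal.comap (aeval (Sum.elim ![MvPolynomial.X 0, MvPolynomial.X 1]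
        ![R, MvPolynomial.X 2] : Fin 2 ⊕ Fin 2 → MvPolynomial (Fin 3) ℂ) :
        MvPolynomial (Fin 2 ⊕ Fin 2) ℂ →ₐ[ℂ] MvPolynomial (Fin 3) ℂ) J := by
    ext q
    simp only [RingHom.mem_ker, Ideal.mem_comap, f, AlgHom.comp_apply,
      Ideal.Quotient.mkₐ_eq_mk, Ideal.Quotient.eq_zero_iff_mem]
  rw [← hker, ringKrullDim_eq_of_ringEquiv (Ideal.quotientKerAlgEquivOfSurjective hf).toRingEquiv,
    hJ, Literature.RingTheory.KrullDimension.ringKrullDim_quotient_span_of_prime_mvPolynomial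
      hprime]

variable (A)

/-- The torus part of `S(A; R)` projects into the curve and contains `{x : A(x) = 0, R(x, t) ≠ 0}`
for every `t ≠ 0`. -/
theorem projAdd_image_relGraphFibre_inter_torusLocus :
    (projAdd '' ({w : Fin 2 ⊕ Fin 2 → ℂ |
        MvPolynomial.eval ![w (Sum.inl 0), w (Sum.inl 1)] A = 0 ∧
        w (Sum.inr 0) = MvPolynomial.eval ![w (Sum.inl 0), w (Sum.inl 1), w (Sum.inr 1)] R} ∩
        torusLocus ℂ 2) ⊆ {x : Fin 2 → ℂ | MvPolynomial.eval x A = 0}) ∧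
    ∀ t : ℂ, t ≠ 0 → {x : Fin 2 → ℂ | MvPolynomial.eval x A = 0 ∧
        MvPolynomial.eval ![x 0, x 1, t] R ≠ 0} ⊆
      projAdd '' ({w : Fin 2 ⊕ Fin 2 → ℂ |
        MvPolynomial.eval ![w (Sum.inl 0), w (Sum.inl 1)] A = 0 ∧
        w (Sum.inr 0) = MvPolynomial.eval ![w (Sum.inl 0), w (Sum.inl 1), w (Sum.inr 1)] R} ∩
        torusLocus ℂ 2) := by
  refine ⟨?_, fun t ht => ?_⟩
  · rintro _ ⟨w, ⟨⟨hA, -⟩, -⟩, rfl⟩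
    have e : (![w (Sum.inl 0), w (Sum.inl 1)] : Fin 2 → ℂ) = projAdd w := by
      funext j; fin_cases j <;> rfl
    rw [e] at hA
    exact hA
  · rintro x ⟨hA, hR⟩
    refine ⟨Sum.elim x ![MvPolynomial.eval ![x 0, x 1, t] R, t], ⟨⟨?_, ?_⟩, fun i => ?_⟩, ?_⟩
    · have e : (![(Sum.elim x ![MvPolynomial.eval ![x 0, x 1, t] R, t] : Fin 2 ⊕ Fin 2 → ℂ)
          (Sum.inl 0), (Sum.elim x ![MvPolynomial.eval ![x 0, x 1, t] R, t] : Fin 2 ⊕ Fin 2 → ℂ)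
          (Sum.inl 1)] : Fin 2 → ℂ) = x := by
        funext j; fin_cases j <;> rfl
      rw [e]; exact hA
    · simp
    · fin_cases i
      · simpa using hR
      · simpa using ht
    · funext j; simp

variable {A R}

/-- **`I(π(S(A; R) ∩ G²)) = (A)`** for irreducible `A`, given a point of `Z(A)` and `t ≠ 0` with
`R(x, t) ≠ 0` (Nullstellensatz). (new) -/
theorem vanishingIdeal_projAdd_relGraphFibre (hirr : Irreducible A)
    (hpt : ∃ (x : Fin 2 → ℂ) (t : ℂ), MvPolynomial.eval x A = 0 ∧ t ≠ 0 ∧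
      MvPolynomial.eval ![x 0, x 1, t] R ≠ 0) :
    vanishingIdeal ℂ (projAdd '' ({w : Fin 2 ⊕ Fin 2 → ℂ |
        MvPolynomial.eval ![w (Sum.inl 0), w (Sum.inl 1)] A = 0 ∧
        w (Sum.inr 0) = MvPolynomial.eval ![w (Sum.inl 0), w (Sum.inl 1), w (Sum.inr 1)] R} ∩
        torusLocus ℂ 2)) = Ideal.span {A} := by
  have hprime : Prime A := UniqueFactorizationMonoid.irreducible_iff_prime.1 hirr
  haveI : (Ideal.span {A} : Ideal (MvPolynomial (Fin 2) ℂ)).IsPrime :=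
    (Ideal.span_singleton_prime hprime.ne_zero).2 hprime
  obtain ⟨hsub, hsup⟩ := projAdd_image_relGraphFibre_inter_torusLocus A R
  obtain ⟨x₀, t, hAx₀, ht, hRx₀⟩ := hpt
  -- the specialisation `R_t(x₀, x₁) = R(x₀, x₁, t)`
  set Rt : MvPolynomial (Fin 2) ℂ := aeval ![MvPolynomial.X 0, MvPolynomial.X 1, MvPolynomial.C t] R
    with hRt
  have hRt_eval : ∀ x : Fin 2 → ℂ, MvPolynomial.eval x Rt = MvPolynomial.eval ![x 0, x 1, t] R := by
    intro x
    rw [hRt, eval_aeval_eq_aeval]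
    have e : (fun i => MvPolynomial.eval x ((![MvPolynomial.X 0, MvPolynomial.X 1, MvPolynomial.C t] :
        Fin 3 → MvPolynomial (Fin 2) ℂ) i)) = ![x 0, x 1, t] := by
      funext i; fin_cases i <;> simp
    rw [e]
    rfl
  refine le_antisymm ?_ ?_
  · intro g hg
    rw [mem_vanishingIdeal_iff] at hg
    have hgR : g * Rt ∈ vanishingIdeal ℂ
        (zeroLocus ℂ (Ideal.span {A} : Ideal (MvPolynomial (Fin 2) ℂ))) := by
      rw [mem_vanishingIdeal_iff]
      intro x hx
      have hAx : MvPolynomial.eval x A = 0 := by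
        have h := (mem_zeroLocus_iff.1 hx) A (Ideal.mem_span_singleton_self A)
        rwa [MvPolynomial.aeval_eq_eval] at h
      rw [map_mul]
      by_cases hRx : MvPolynomial.eval ![x 0, x 1, t] R = 0
      · have h0 : MvPolynomial.aeval x Rt = 0 := by
          show MvPolynomial.eval x Rt = 0
          rw [hRt_eval, hRx]
        rw [h0, mul_zero]
      · have h := hg x (hsup t ht ⟨hAx, hRx⟩)
        rw [h, zero_mul]
    rw [MvPolynomial.IsPrime.vanishingIdeal_zeroLocus, Ideal.mem_span_singleton] at hgR
    rcases hprime.dvd_or_dvd hgR with h | h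
    · exact Ideal.mem_span_singleton.2 h
    · exfalso
      obtain ⟨c, hc⟩ := h
      apply hRx₀
      rw [← hRt_eval, hc, map_mul, hAx₀, zero_mul]
  · intro g hg
    rw [Ideal.mem_span_singleton] at hg
    obtain ⟨c, rfl⟩ := hg
    rw [mem_vanishingIdeal_iff]
    intro x hx
    rw [map_mul, MvPolynomial.aeval_eq_eval, hsub hx, zero_mul]

/-- **Case certificate for graph fibres involving `y₁` over an arbitrary plane curve.**  `A`
irreducible, a point of `Z(A)` and `t ≠ 0` with `R(x, t) ≠ 0`, and `Z(A)` not contained in a line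
of rational slope: `S(A; R)` satisfies the hypotheses of Mantova–Masser's case (dim-π-S-1-free).
(new) -/
theorem mmCase_relGraphFibre (hirr : Irreducible A)
    (hpt : ∃ (x : Fin 2 → ℂ) (t : ℂ), MvPolynomial.eval x A = 0 ∧ t ≠ 0 ∧
      MvPolynomial.eval ![x 0, x 1, t] R ≠ 0)
    (hline : ∀ m : Fin 2 → ℤ, m ≠ 0 → ∀ c : ℂ, ∃ x : Fin 2 → ℂ,
      MvPolynomial.eval x A = 0 ∧ (m 0 : ℂ) * x 0 + (m 1 : ℂ) * x 1 ≠ c) :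
    MMCaseDimPiOneFree {w : Fin 2 ⊕ Fin 2 → ℂ |
        MvPolynomial.eval ![w (Sum.inl 0), w (Sum.inl 1)] A = 0 ∧
        w (Sum.inr 0) = MvPolynomial.eval ![w (Sum.inl 0), w (Sum.inl 1), w (Sum.inr 1)] R} := by
  have hprime : Prime A := UniqueFactorizationMonoid.irreducible_iff_prime.1 hirr
  refine ⟨isIrreducibleClosed_relGraphFibre R hirr, ?_, zariskiDim_relGraphFibre R hirr, ?_, ?_⟩
  · obtain ⟨x, t, hAx, ht, hRx⟩ := hpt
    obtain ⟨w, hw, -⟩ := (projAdd_image_relGraphFibre_inter_torusLocus A R).2 t ht ⟨hAx, hRx⟩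
    exact ⟨w, hw⟩
  · unfold addProjDim zariskiDim
    rw [vanishingIdeal_projAdd_relGraphFibre hirr hpt,
      Literature.RingTheory.KrullDimension.ringKrullDim_quotient_span_of_prime_mvPolynomial hprime]
  · rw [vanishingIdeal_projAdd_relGraphFibre hirr hpt]
    rintro ⟨m, hm, c, hL⟩
    obtain ⟨x, hAx, hx⟩ := hline m hm c
    have hxZ : x ∈ zeroLocus ℂ (Ideal.span {A} : Ideal (MvPolynomial (Fin 2) ℂ)) := by
      rw [mem_zeroLocus_iff]
      intro p hp
      rw [Ideal.mem_span_singleton] at hp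
      obtain ⟨q, rfl⟩ := hp
      rw [map_mul, MvPolynomial.aeval_eq_eval, hAx, zero_mul]
    rw [hL] at hxZ
    exact hx hxZ

end RelGraphFibre

end Summit.Schanuel.Schanuel.Theorems

end
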